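import Summits.HodgeConjecture.HodgeConjecture.Theorems.NikulinTwinTransportRealMultiplicationAnchorOfAlgebraic
import Summits.HodgeConjecture.HodgeConjecture.Theorems.NikulinTwinTransportSquareTranscendental
import Summits.HodgeConjecture.HodgeConjecture.Theorems.NikulinTwinTransportRealMultiplicationDivisorCorrespondences
import Literature.AlgebraicGeometry.Surfaces.K3HodgeTypesHolds

/-!
# Crux `TwinTransportRMPicardTwo` (stmt-HodgeConjecture-15067), line `Sketch` — stub
# `stub_rm_of_hecke`: the Néron–Severi correction of a Hecke operator

Helper file (`--supports stmt-HodgeConjecture-15067`) for the line `Sketch` (dihedral Hecke octagon)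
of the crux `Summit.HodgeConjecture.HodgeConjecture.Theses.NikulinTwinTransport.TwinTransportRMPicardTwo`.

Let `S` be a projective K3 surface, `N := algebraicClasses S 1 = N¹H²` its Néron–Severi classes and
`N^⊥ := {x | ∀ d ∈ N, x ∪ d = 0}` the transcendental classes. Let `T` be an endomorphism of
`H²(S(ℂ); ℂ)` which is rational, type-preserving, cup-self-adjoint, maps `N` into `N`, satisfies
`T (T x) = 2 x` on `N^⊥`, and is the action `[γ]_* = pr₁₊(pr₂^*(–) ∪ γ)` of an ALGEBRAIC
self-correspondence `γ ∈ N²H⁴(S × S)` (in the line: the Hecke operator `π₊ σ^* π^* + π₊ σ'^* π^*` of an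
octagonal cover). Then (`stub_rm_of_hecke`) the corrected endomorphism

  `e := T - T ∘ π_N`,

`π_N` the projection onto `N` along `N^⊥` (`exists_nsProjection`: `H² = N ⊕ N^⊥` by the Hodge index
theorem and the non-degeneracy of the cup form, Huybrechts Ch. 3 §2.2 / Lemma 3.3.1), is a real
multiplication in the route's sense:

* `e` kills `N` (`π_N d = d`), and `e = T` on `N^⊥` (`π_N t = 0`), which `T` preserves
  (self-adjointness + `T N ⊆ N`), so `e (e x) = T (T x) = 2 x` there;
* `e` is rational and type-preserving, because `T` and `π_N` are;
* `e` is cup-self-adjoint: both `e x ∪ y` and `x ∪ e y` equal `T (x - π_N x) ∪ (y - π_N y)` (the cross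
  terms `T(π_N x) ∪ (y - π_N y)`, `(x - π_N x) ∪ T (π_N y)` vanish as `T N ⊆ N ⊥ (𝟙 - π_N) H²`);
* `e` is ALGEBRAIC: `T ∘ π_N` has image in `N` and kills `N^⊥`, so it is a finite sum of rank-one maps
  `x ↦ (ηx.ηaᵢ) bᵢ` with `aᵢ, bᵢ ∈ N` (`exists_rankOne_of_range_le`), each of which is the action of
  the divisor correspondence `c⁻¹ · pr₁^* bᵢ ∪ pr₂^* aᵢ` (`divisorCorrespondence_of_fibreIntegral`,
  fibre integral `pr₁₊ pr₂^* p₀ = c · 1` from the Künneth theorem, `fibreIntegral_of_kunnethTop`), and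
  correspondence actions form a `ℂ`-linear subspace (`induced_sub`, `induced_sum`; Fulton §16.1).

Inputs: the named facts `Huybrechts_K3_marking_exists`, `Grothendieck1969_supportedClasses_le_hodgeConiveau`
and `hodgeIndex_surface S` as explicit hypotheses (as in the skeleton); the bigrading of the cup
product on `S` from de Rham's theorem (`exists_deRhamIsoFamily_holds`, proved). No sorry, no new
axioms. Lead seat prover-line-stmt-HodgeConjecture-15067-0.

## References

* [Huybrechts2016K3] D. Huybrechts, *Lectures on K3 Surfaces*, CUP 2016, Ch. 3 §2.2 and Lemma 3.3.1.
* [Fulton1998] W. Fulton, *Intersection Theory*, 2nd ed., Springer 1998, §16.1 Prop. 16.1.1–16.1.2.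
-/

set_option linter.dupNamespace false

noncomputable section

namespace Summit.HodgeConjecture.HodgeConjecture.Theorems.NikulinTwinTransport

open scoped Manifold
open CategoryTheory MonoidalCategory SemiCartesianMonoidalCategory
open Literature.AlgebraicGeometry.Motives Literature.AlgebraicGeometry.HodgeTheory
open Literature.AlgebraicGeometry.Surfaces Literature.Geometry.Kaehler
open Literature.AlgebraicTopology.SingularHomology

/-- **Néron–Severi correction of a Hecke operator.** On a projective K3 surface `S` (granted
markings, Grothendieck's coniveau inclusion and the Hodge index theorem for `S`), an endomorphism `T`
of `H²(S(ℂ); ℂ)` which is rational, type-preserving, cup-self-adjoint, maps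
`NS = algebraicClasses S 1` into itself, satisfies `T (T x) = 2 x` on `NS^⊥` and is the action of an
algebraic self-correspondence yields a real multiplication in the route's sense:
`e = T - T ∘ π_N` (`π_N` the projection onto `NS` along `NS^⊥`, `exists_nsProjection`) is rational,
type-preserving, self-adjoint, kills `NS`, has `e (e x) = 2 x` on `NS^⊥`, and is algebraic
(`T ∘ π_N` is a sum of divisor correspondences, `exists_rankOne_of_range_le` +
`divisorCorrespondence_of_fibreIntegral`). [cite: Huybrechts2016K3, Ch. 3 §2.2 and Lemma 3.3.1]
[cite: Fulton1998, §16.1] -/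
theorem stub_rm_of_hecke : Huybrechts_K3_marking_exists →
    Grothendieck1969_supportedClasses_le_hodgeConiveau →
    ∀ (μ : OrientationFamily), μ.HasPoincareDuality → ∀ (S : SchemeOver ℂ) (hS : IsK3Surface S),
      hodgeIndex_surface S →
      ∀ (T : complexBetti S (2 * 1) →ₗ[ℂ] complexBetti S (2 * 1)),
      (∀ x, IsRationalClass x → IsRationalClass (T x)) →
      (∀ (i j : ℕ) x, IsOfHodgeType 2 S (2 * 1) i j x → IsOfHodgeType 2 S (2 * 1) i j (T x)) →
      (∀ x y : complexBetti S (2 * 1), cupProduct (rfl : 2 * 1 + 2 * 1 = 2 * 2) (T x) y =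
          cupProduct (rfl : 2 * 1 + 2 * 1 = 2 * 2) x (T y)) →
      (∀ d ∈ algebraicClasses S 1, T d ∈ algebraicClasses S 1) →
      (∀ x : complexBetti S (2 * 1),
          (∀ d ∈ algebraicClasses S 1, cupProduct (rfl : 2 * 1 + 2 * 1 = 2 * 2) x d = 0) →
            T (T x) = (2 : ℂ) • x) →
      (∃ γ ∈ algebraicClasses (S ⊗ S) 2, ∀ x : complexBetti S (2 * 1), T x =
          complexGysin μ (IsSmoothProjective.tensor_holds hS.1 hS.1) hS.1 (fst S S)
            (rfl : 2 * 1 + 2 * 2 + 2 * 2 = 2 * 1 + 2 * (2 + 2))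
            (cupProduct (rfl : 2 * 1 + 2 * 2 = 2 * 1 + 2 * 2)
              (complexBetti.map (snd S S) (2 * 1) x) γ)) →
      ∃ e : complexBetti S (2 * 1) →ₗ[ℂ] complexBetti S (2 * 1),
        (∀ x, IsRationalClass x → IsRationalClass (e x)) ∧
        (∀ (i j : ℕ) x, IsOfHodgeType 2 S (2 * 1) i j x → IsOfHodgeType 2 S (2 * 1) i j (e x)) ∧
        (∀ x y : complexBetti S (2 * 1), cupProduct (rfl : 2 * 1 + 2 * 1 = 2 * 2) (e x) y =
            cupProduct (rfl : 2 * 1 + 2 * 1 = 2 * 2) x (e y)) ∧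
        (∀ d ∈ algebraicClasses S 1, e d = 0) ∧
        (∀ x : complexBetti S (2 * 1),
            (∀ d ∈ algebraicClasses S 1, cupProduct (rfl : 2 * 1 + 2 * 1 = 2 * 2) x d = 0) →
              e (e x) = (2 : ℂ) • x) ∧
        (∃ γ ∈ algebraicClasses (S ⊗ S) 2, ∀ x : complexBetti S (2 * 1), e x =
            complexGysin μ (IsSmoothProjective.tensor_holds hS.1 hS.1) hS.1 (fst S S)
              (rfl : 2 * 1 + 2 * 2 + 2 * 2 = 2 * 1 + 2 * (2 + 2))
              (cupProduct (rfl : 2 * 1 + 2 * 2 = 2 * 1 + 2 * 2)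
                (complexBetti.map (snd S S) (2 * 1) x) γ)) := by
  intro hmark hG μ hμ S hS hHI T hTr hTt hTadj hTN hT2 hTalg
  classical
  set N := algebraicClasses S 1 with hNdef
  -- a marking: the cup form `x ∪ y = (ηx.ηy) • p₀`, integral classes `↔ ℤ²²`
  obtain ⟨η, p₀, x₀, hp₀, ⟨-, -, hηint, hηcup, -, -⟩, -⟩ := hmark S hS
  obtain ⟨A⟩ := hS.nonempty_hodgeModel
  -- the cup product on `S` is bigraded (de Rham's theorem in multiplicative form)
  have hcupS : CupPreservesHodgeType 2 S :=
    hS.cupPreservesHodgeType_of_exists_deRhamIsoFamily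
      fun E _ _ _ => Literature.NumberTheory.Transcendental.exists_deRhamIsoFamily_holds (E := E)
  -- `N ⊆ H^{1,1}` (Grothendieck's coniveau inclusion)
  have hN11 : ∀ d ∈ N, IsOfHodgeType 2 S (2 * 1) 1 1 d :=
    fun d hd => isOfHodgeType_oneOne_of_mem_algebraicClasses hG hS hd
  -- the projection onto `N` along `N^⊥`
  obtain ⟨π, hπN, hπid, hπT, hπorth, hπr, hπtype⟩ :=
    exists_nsProjection hS η hp₀ hηint hηcup hHI A hcupS hN11
  -- the cup product of `H²` is symmetric
  have hcomm : ∀ x y : complexBetti S (2 * 1), cupProduct (rfl : 2 * 1 + 2 * 1 = 2 * 2) x y =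
      cupProduct (rfl : 2 * 1 + 2 * 1 = 2 * 2) y x := fun x y => by
    rw [hηcup, hηcup, k3Form_comm]
  -- `T` preserves `N^⊥` (self-adjointness and `T N ⊆ N`)
  have hTorth : ∀ x : complexBetti S (2 * 1),
      (∀ d ∈ N, cupProduct (rfl : 2 * 1 + 2 * 1 = 2 * 2) x d = 0) →
        ∀ d ∈ N, cupProduct (rfl : 2 * 1 + 2 * 1 = 2 * 2) (T x) d = 0 :=
    fun x hx d hd => by rw [hTadj, hx _ (hTN d hd)]
  -- the corrected endomorphism
  set e : complexBetti S (2 * 1) →ₗ[ℂ] complexBetti S (2 * 1) := T - T ∘ₗ π with hedef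
  have he : ∀ x, e x = T x - T (π x) := fun x => rfl
  -- on `N^⊥`, `e = T`
  have heT : ∀ x : complexBetti S (2 * 1),
      (∀ d ∈ N, cupProduct (rfl : 2 * 1 + 2 * 1 = 2 * 2) x d = 0) → e x = T x := fun x hx => by
    rw [he, hπT x hx, map_zero, sub_zero]
  refine ⟨e, ?_, ?_, ?_, ?_, ?_, ?_⟩
  · -- (R) rationality
    intro x hx
    have hneg : ∀ c : complexBetti S (2 * 1), -c = ((-1 : ℚ) : ℂ) • c := fun c => by
      rw [Rat.cast_neg, Rat.cast_one, neg_one_smul]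
    rw [he, sub_eq_add_neg, hneg]
    exact (hTr x hx).add ((hTr _ (hπr x hx)).smul _)
  · -- (H) Hodge types
    intro i j x hx
    rw [he]
    exact (hTt i j x hx).sub hS.1 (hTt i j _ (hπtype i j x hx).1)
  · -- (A) self-adjointness: both sides equal `T (x - π x) ∪ (y - π y)`
    intro x y
    have hx : T x = T (x - π x) + T (π x) := by rw [← map_add, sub_add_cancel]
    have hy : T y = T (y - π y) + T (π y) := by rw [← map_add, sub_add_cancel]
    have hL : cupProduct (rfl : 2 * 1 + 2 * 1 = 2 * 2) (e x) y =
        cupProduct (rfl : 2 * 1 + 2 * 1 = 2 * 2) (T (x - π x)) (y - π y) := by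
      rw [he, ← map_sub, hTadj, hy, map_add, hπorth x _ (hTN _ (hπN y)), add_zero, ← hTadj]
    have hR : cupProduct (rfl : 2 * 1 + 2 * 1 = 2 * 2) x (e y) =
        cupProduct (rfl : 2 * 1 + 2 * 1 = 2 * 2) (T (x - π x)) (y - π y) := by
      rw [he, ← map_sub, ← hTadj, hx, map_add, LinearMap.add_apply,
        hcomm (T (π x)) (y - π y), hπorth y _ (hTN _ (hπN x)), add_zero]
    rw [hL, hR]
  · -- (N) `e` kills `N`
    intro d hd
    rw [he, hπid d hd, sub_self]
  · -- (T2) `e (e x) = T (T x) = 2 x` on `N^⊥`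
    intro x hx
    rw [heT x hx, heT (T x) (hTorth x hx), hT2 x hx]
  · -- (G) algebraicity: `T ∘ π` is a sum of divisor correspondences
    obtain ⟨m, a, b, ha, hb, hsum⟩ := exists_rankOne_of_range_le η hp₀ hηcup (T ∘ₗ π)
      (fun x => hTN _ (hπN x)) (fun t ht => by rw [LinearMap.comp_apply, hπT t ht, map_zero])
    set ψ : Fin m → (complexBetti S (2 * 1) →ₗ[ℂ] complexBetti S (2 * 1)) := fun i =>
      ((k3FormC.flip (η (a i))) ∘ₗ η.toLinearMap).smulRight (b i) with hψdef
    have hψ : ∀ i x, ψ i x = k3Form (η x) (η (a i)) • b i := by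
      intro i x
      rw [hψdef]
      change ((k3FormC.flip (η (a i))) ∘ₗ η.toLinearMap) x • b i = _
      rw [LinearMap.comp_apply, LinearEquiv.coe_coe, LinearMap.BilinForm.flip_apply, k3FormC_apply]
    have hTπ : T ∘ₗ π = ∑ i, ψ i := by
      refine LinearMap.ext fun x => ?_
      rw [hsum x, LinearMap.sum_apply]
      exact Finset.sum_congr rfl fun i _ => (hψ i x).symm
    obtain ⟨c, hc, hκ⟩ := fibreIntegral_of_kunnethTop μ hS.1 hS.1
      (kunnethSpan_complexBetti hS.1 hS.1 (2 * (2 + 2))) hp₀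
    have hψind : ∀ i ∈ (Finset.univ : Finset (Fin m)), ∃ γ' ∈ algebraicClasses (S ⊗ S) 2,
        ∀ x : complexBetti S (2 * 1), ψ i x =
          complexGysin μ (IsSmoothProjective.tensor_holds hS.1 hS.1) hS.1 (fst S S)
            (rfl : 2 * 1 + 2 * 2 + 2 * 2 = 2 * 1 + 2 * (2 + 2))
            (cupProduct (rfl : 2 * 1 + 2 * 2 = 2 * 1 + 2 * 2)
              (complexBetti.map (snd S S) (2 * 1) x) γ') := by
      intro i _
      obtain ⟨γ', hγ', hγ'eq⟩ :=
        divisorCorrespondence_of_fibreIntegral μ hμ S hS p₀ c hc hκ (ha i) (hb i)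
      refine ⟨γ', hγ', fun x => ?_⟩
      rw [hψ i x]
      exact (hγ'eq x _ (hηcup x (a i))).symm
    have hνind := induced_sum (IsSmoothProjective.tensor_holds hS.1 hS.1) hS.1
      (rfl : 2 * 1 + 2 * 2 = 2 * 1 + 2 * 2) (rfl : 2 * 1 + 2 * 2 + 2 * 2 = 2 * 1 + 2 * (2 + 2))
      Finset.univ ψ hψind
    have h := induced_sub (IsSmoothProjective.tensor_holds hS.1 hS.1) hS.1
      (rfl : 2 * 1 + 2 * 2 = 2 * 1 + 2 * 2) (rfl : 2 * 1 + 2 * 2 + 2 * 2 = 2 * 1 + 2 * (2 + 2))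
      hTalg hνind
    rw [← hTπ, ← hedef] at h
    exact h

end Summit.HodgeConjecture.HodgeConjecture.Theorems.NikulinTwinTransport

end
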